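import Mathlib
import Summits.Ventures.HodgeRepro.Tier4.Target
import Summits.Ventures.HodgeRepro.Tier4.Line3.Defs
import Summits.Ventures.HodgeRepro.Tier4.Line3.LocaliserS
import Summits.Ventures.HodgeRepro.Tier4.Line3.ClassBoundGauss
import Summits.Ventures.HodgeRepro.Tier4.Line3.GrowthInvOfGauss
import Summits.Ventures.HodgeRepro.Tier4.Line3.GrowthInvOfMajorant
import Summits.Ventures.HodgeRepro.Tier4.Line3.HeckeMassBounds

/-!
# Tier4/Line3/GaussGrowthOfSize — (G₀-c): the pointwise Gauss-growth clause from (cf-G) and the size clause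

Blind re-derivation cell `pub-hodge-repro`, Tier 4 «PROVE THE STEP» (README §9–§10), LINE L3, seat t4-L2-p1 g2:
piece (G₀-c) of the (G₀) cut (lead S13215 / S13252, plan-3 g2's split S13245 and v2 S13262 / S13275; statement
VERBATIM from proofs/t4-plan-3/Tier4/Line3/G0Cut-sketch-v2.lean).

(G₀) `GaussGrowth D ℓ` — `‖coefQ D.cf (ℓ.loc N) (rep w)‖ ≤ B q₂^N ∏_k gaussDefAt c₀ (rep w k)` — is derived for ANY
localiser from two clauses with no `Γ`-quantifier and no `τ₀`-polynomial: (cf-G) `SlotGauss D` on the DATA (the slot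
functions bounded by a constant times the product of the definite Gaussians, HeckeMassBounds p676714 = `ThetaData.decay`
with exponent `0`) and `LocSize D ℓ` on the LOCALISER (t4-L2-p3 g3, GrowthInvOfMajorant p676532: the ℓ¹-size `trSize`
of the depth-`N` combination is `≤ B q₂^N`).  Mechanism: every coset representative `r` of a term of the level-`K`
Hecke elements of the combination is unitary (`isUnitaryOf_of_isFor`, (G₀-b)), so the Gaussian at the translate is
read back at the point at the cost of the reverse comparability constant `R` (`gaussDefAt_mulVec_le`,
`exists_uniform_comparability_rev`): `‖cf j (r x_j)‖ ≤ C gaussDefAt c₀ (r x_j) ≤ C gaussDefAt (c₀/R) (x_j)`; the ℓ¹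
bound `norm_heckeAct_le` then gives `‖(h_j · cf j)(x_j)‖ ≤ heckeSize (h_j) · C gaussDefAt (c₀/R) (x_j)` per slot, and
the `Finsupp.sum` of `coefQ` against `trSize` gives `‖coefQ (loc N) x‖ ≤ trSize (loc N) · C⁴ ∏_k gaussDefAt (c₀/R) (x_k)
≤ B C⁴ q₂^N ∏_k gaussDefAt (c₀/R) (x_k)`.  Witnesses: `(B (max C 0)⁴, q₂, c₀ / R)`.

With `growthInv_of_gaussGrowth` (GrowthInvOfGauss p675191) this closes the growth interface of the invariant route of
L3.5 to «(cf-G) on the data + `LocSize` on the localiser» (`growthInv_of_locSize`, `term_dominated_of_locSize_lit`).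
Nothing here asserts anything about the truth of (P); HC_CM is NOT proved by anyone in this repository.
-/

set_option autoImplicit false

noncomputable section

namespace Summit.Ventures.HodgeRepro.Tier4.Line3

open Summit.Ventures.HodgeRepro.Tier4
open Matrix NumberField
open scoped ComplexConjugate

namespace T4Data

variable (X : T4Data)

/-- **The slot bound with the Gaussian read back at the point**: for a quadruple `h` of level `K`, a slot `k` and `x`,
`‖(h_k · cf k)(x_k)‖ ≤ heckeSize (h_k) · (C · gaussDefAt (c₀ / R) (x_k))` — every representative is unitary
((G₀-b)), so `gaussDefAt c₀ (r x_k) ≤ gaussDefAt (c₀ / R) (x_k)`. -/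
theorem norm_heckeAct_slot_le_gauss (D : X.ThetaData) {K : X.Level} {R : ℝ} (hRpos : 0 < R)
    (hR : ∀ σ : X.E →+* ℂ, σ ≠ X.τ₀ → σ ≠ conjEmb X.τ₀ →
      ∀ γ : Matrix (Fin 3) (Fin 3) X.E, IsUnitaryOf X.c X.H γ → ∀ x : Fin 3 → X.E,
        ∑ i, ‖σ (x i)‖ ^ 2 ≤ R * ∑ i, ‖σ ((γ *ᵥ x) i)‖ ^ 2)
    {C c₀ : ℝ} (hC : 0 ≤ C) (hc₀ : 0 ≤ c₀) (hcf : ∀ j x, ‖D.cf j x‖ ≤ C * X.gaussDefAt c₀ x)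
    (h : X.TrZ K) (k : Fin 4) (x : X.Tuple) :
    ‖X.heckeAct (h.1 (X.slot k)) (D.cf k) (x k)‖ ≤
      heckeSize (h.1 (X.slot k)) * (C * X.gaussDefAt (c₀ / R) (x k)) := by
  refine X.norm_heckeAct_le _ _ _ fun t ht r hr => ?_
  have hr' : IsUnitaryOf X.c X.H r := X.isUnitaryOf_of_isFor (h.2 (X.slot k)) ht hr
  calc ‖D.cf k (r *ᵥ x k)‖ ≤ C * X.gaussDefAt c₀ (r *ᵥ x k) := hcf k _
    _ ≤ C * X.gaussDefAt (c₀ / R) (x k) :=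
        mul_le_mul_of_nonneg_left (X.gaussDefAt_mulVec_le hRpos hR hc₀ hr' (x k)) hC

/-- **The coefficient of a combination is bounded by its ℓ¹-size times the Gaussians at the point**:
`‖coefQ cf γ x‖ ≤ trSize γ · (C⁴ ∏_k gaussDefAt (c₀ / R) (x_k))` under (cf-G). -/
theorem norm_coefQ_le_trSize_gauss (D : X.ThetaData) {K : X.Level} (γ : X.TrZ K →₀ ℂ) {R : ℝ} (hRpos : 0 < R)
    (hR : ∀ σ : X.E →+* ℂ, σ ≠ X.τ₀ → σ ≠ conjEmb X.τ₀ →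
      ∀ γ : Matrix (Fin 3) (Fin 3) X.E, IsUnitaryOf X.c X.H γ → ∀ x : Fin 3 → X.E,
        ∑ i, ‖σ (x i)‖ ^ 2 ≤ R * ∑ i, ‖σ ((γ *ᵥ x) i)‖ ^ 2)
    {C c₀ : ℝ} (hC : 0 ≤ C) (hc₀ : 0 ≤ c₀) (hcf : ∀ j x, ‖D.cf j x‖ ≤ C * X.gaussDefAt c₀ x) (x : X.Tuple) :
    ‖X.coefQ D.cf γ x‖ ≤ X.trSize γ * (C ^ 4 * ∏ k, X.gaussDefAt (c₀ / R) (x k)) := by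
  unfold coefQ trSize Finsupp.sum
  refine (norm_sum_le _ _).trans ?_
  rw [Finset.sum_mul]
  refine Finset.sum_le_sum fun h _ => ?_
  dsimp only
  have h0 := X.norm_heckeAct_slot_le_gauss D hRpos hR hC hc₀ hcf h 0 x
  have h1 := X.norm_heckeAct_slot_le_gauss D hRpos hR hC hc₀ hcf h 1 x
  have h2 := X.norm_heckeAct_slot_le_gauss D hRpos hR hC hc₀ hcf h 2 x
  have h3 := X.norm_heckeAct_slot_le_gauss D hRpos hR hC hc₀ hcf h 3 x
  have hS0 := heckeSize_nonneg (h.1 (X.slot 0))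
  have hS1 := heckeSize_nonneg (h.1 (X.slot 1))
  have hS2 := heckeSize_nonneg (h.1 (X.slot 2))
  have hS3 := heckeSize_nonneg (h.1 (X.slot 3))
  have hg0 := X.gaussDefAt_nonneg (c₀ / R) (x 0)
  have hg1 := X.gaussDefAt_nonneg (c₀ / R) (x 1)
  have hg2 := X.gaussDefAt_nonneg (c₀ / R) (x 2)
  have hg3 := X.gaussDefAt_nonneg (c₀ / R) (x 3)
  have hA0 : 0 ≤ heckeSize (h.1 (X.slot 0)) * (C * X.gaussDefAt (c₀ / R) (x 0)) := mul_nonneg hS0 (mul_nonneg hC hg0)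
  have hA1 : 0 ≤ heckeSize (h.1 (X.slot 1)) * (C * X.gaussDefAt (c₀ / R) (x 1)) := mul_nonneg hS1 (mul_nonneg hC hg1)
  have hA2 : 0 ≤ heckeSize (h.1 (X.slot 2)) * (C * X.gaussDefAt (c₀ / R) (x 2)) := mul_nonneg hS2 (mul_nonneg hC hg2)
  rw [norm_mul, norm_mul, norm_mul, Complex.norm_conj, norm_mul]
  rw [Fin.prod_univ_four]
  calc ‖γ h‖ *
        (‖X.heckeAct (h.1 (X.slot 0)) (D.cf 0) (x 0)‖ * ‖X.heckeAct (h.1 (X.slot 1)) (D.cf 1) (x 1)‖) *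
        (‖X.heckeAct (h.1 (X.slot 2)) (D.cf 2) (x 2)‖ * ‖X.heckeAct (h.1 (X.slot 3)) (D.cf 3) (x 3)‖)
      ≤ ‖γ h‖ * ((heckeSize (h.1 (X.slot 0)) * (C * X.gaussDefAt (c₀ / R) (x 0))) *
          (heckeSize (h.1 (X.slot 1)) * (C * X.gaussDefAt (c₀ / R) (x 1)))) *
        ((heckeSize (h.1 (X.slot 2)) * (C * X.gaussDefAt (c₀ / R) (x 2))) *
          (heckeSize (h.1 (X.slot 3)) * (C * X.gaussDefAt (c₀ / R) (x 3)))) :=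
        mul_le_mul (mul_le_mul_of_nonneg_left (mul_le_mul h0 h1 (norm_nonneg _) hA0) (norm_nonneg _))
          (mul_le_mul h2 h3 (norm_nonneg _) hA2) (mul_nonneg (norm_nonneg _) (norm_nonneg _))
          (mul_nonneg (norm_nonneg _) (mul_nonneg hA0 hA1))
    _ = ‖γ h‖ * (heckeSize (h.1 (X.slot 0)) * heckeSize (h.1 (X.slot 1)) *
          (heckeSize (h.1 (X.slot 2)) * heckeSize (h.1 (X.slot 3)))) *
        (C ^ 4 * (X.gaussDefAt (c₀ / R) (x 0) * X.gaussDefAt (c₀ / R) (x 1) * X.gaussDefAt (c₀ / R) (x 2) *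
          X.gaussDefAt (c₀ / R) (x 3))) := by ring

/-- **(G₀-c) THE CUT: (G₀) for a localiser from (cf-G) on the data and the size clause on the localiser** —
witnesses `(B (max C 0)⁴, q₂, c₀ / R)`, `R` the uniform reverse comparability constant. -/
theorem gaussGrowth_of_locSize (D : X.ThetaData) {p : IsDedekindDomain.HeightOneSpectrum (RingOfIntegers X.E)}
    {L₀ : Submodule (RingOfIntegers X.E) (Fin 3 → X.E)} {xm : X.Tuple} (ℓ : X.LocS D p L₀ xm)
    (hcf : X.SlotGauss D) (hsize : X.LocSize D ℓ) : X.GaussGrowth D ℓ := by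
  obtain ⟨C, c₀, hc₀, hcf⟩ := hcf
  obtain ⟨B, q₂, _hB, hq₂, hsize⟩ := hsize
  obtain ⟨R, hR1, hR⟩ := X.exists_uniform_comparability_rev
  have hRpos : 0 < R := zero_lt_one.trans_le hR1
  have hcf' : ∀ j x, ‖D.cf j x‖ ≤ max C 0 * X.gaussDefAt c₀ x := fun j x =>
    (hcf j x).trans (mul_le_mul_of_nonneg_right (le_max_left _ _) (X.gaussDefAt_nonneg _ _))
  refine ⟨B * max C 0 ^ 4, q₂, c₀ / R, by positivity, hq₂, fun N w => ?_⟩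
  have hprod : 0 ≤ max C 0 ^ 4 * ∏ k, X.gaussDefAt (c₀ / R) (X.rep w k) :=
    mul_nonneg (by positivity) (Finset.prod_nonneg fun k _ => X.gaussDefAt_nonneg _ _)
  calc ‖X.coefQ D.cf (ℓ.loc N) (X.rep w)‖
      ≤ X.trSize (ℓ.loc N) * (max C 0 ^ 4 * ∏ k, X.gaussDefAt (c₀ / R) (X.rep w k)) :=
        X.norm_coefQ_le_trSize_gauss D (ℓ.loc N) hRpos hR (le_max_right _ _) hc₀.le hcf' (X.rep w)
    _ ≤ B * q₂ ^ N * (max C 0 ^ 4 * ∏ k, X.gaussDefAt (c₀ / R) (X.rep w k)) :=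
        mul_le_mul_of_nonneg_right (hsize N) hprod
    _ = B * max C 0 ^ 4 * q₂ ^ N * ∏ k, X.gaussDefAt (c₀ / R) (X.rep w k) := by ring

/-- The `Γ`-invariant growth clause from (cf-G) and `LocSize`, by name. -/
theorem growthInv_of_locSize (D : X.ThetaData) {p : IsDedekindDomain.HeightOneSpectrum (RingOfIntegers X.E)}
    {L₀ : Submodule (RingOfIntegers X.E) (Fin 3 → X.E)} {xm : X.Tuple} (ℓ : X.LocS D p L₀ xm)
    (hcf : X.SlotGauss D) (hsize : X.LocSize D ℓ) : X.GrowthInv D p L₀ xm ℓ :=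
  X.growthInv_of_gaussGrowth D ℓ (X.gaussGrowth_of_locSize D ℓ hcf hsize)

/-- **L3.5 FROM (cf-G), `LocSize` AND BOREL–HARISH-CHANDRA ALONE** (the invariant route,
`term_dominated_of_growthInv_lit`, InvariantRouteFinal p674963). -/
theorem term_dominated_of_locSize_lit (D : X.ThetaData)
    (p : IsDedekindDomain.HeightOneSpectrum (RingOfIntegers X.E))
    (L₀ : Submodule (RingOfIntegers X.E) (Fin 3 → X.E)) (xm : X.Tuple)
    (h02 : xm 2 = xm 0) (h13 : xm 3 = xm 1) (hab : LinearIndependent X.E ![xm 0, xm 1]) (ℓ : X.LocS D p L₀ xm)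
    (hcf : X.SlotGauss D) (hsize : X.LocSize D ℓ)
    (hlit : Lit.BorelHarishChandra1962_Thm11_8_fundamentalDomain_hdef X.E X.H X.τ₀ X.C) :
    ∃ bound : X.Orbit → ℝ, (∀ o, 0 ≤ bound o) ∧ Summable bound ∧
      ∀ N (o : X.Orbit), o ≠ X.orbitOf (X.lines xm) →
        ‖X.term D.Φ D.cf (ℓ.level N) (ℓ.loc N) o‖ ≤ bound o :=
  X.term_dominated_of_gaussGrowth_lit D p L₀ xm h02 h13 hab ℓ (X.gaussGrowth_of_locSize D ℓ hcf hsize) hlit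

end T4Data

end Summit.Ventures.HodgeRepro.Tier4.Line3

end
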